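import Summits.BirchSwinnertonDyer.BirchSwinnertonDyer.Theorems.ThetaPartnerAtTwoSignedKatoUpToAtTwoOffTwoLocalPackage
import Summits.BirchSwinnertonDyer.BirchSwinnertonDyer.Theorems.ThetaPartnerAtTwoSignedKatoUpToAtTwoFineStrictRat
import HarnessLib

/-!
# Route `ThetaPartnerAtTwo` (TP2), crux K3 `SignedKatoDivisibilityUpToAtTwo` (item stmt-BirchSwinnertonDyer-20308),
# line `colemanrat` v3: **K3 BY NAME, modulo print, from the LOCALISED `2`-robust package — ONE-PLACE CURRENCY.** The
# local cover of `…OffTwoLocalPackage` quantified «locally trivial above 2» over every place `v ∋ 2` and every conjugate;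
# over the cyclotomic `ℤ₂`-extension of `ℚ` that is ONE vanishing `res_𝔭 t = 0` in `H¹(ℚ_{∞,𝔭}, E[2^∞])` at the unique
# prime `𝔭 ∣ 2` of `ℚ_∞` (`…FineStrictRat.strictAt_iff_resOfLe_eq_zero_rat`). This file restates both certificates in that
# final currency — the shape of Kobayashi's (7.17), ONE local term `H¹(k_n, T)/H¹_±` at `p`.

Width seat `bsd-wall-tp2-p2x-w3` g2 (cell `bsd-wall`). HONEST FRAMING: THEOREMS ONLY — no definition, no named fact, no
instance, no `sorry`; CONDITIONAL on the displayed hypotheses (Kato 13.4 (2) at `p = 2`, Gross–Zagier–Kolyvagin BY NAME; one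
research package at `p = 2`); closes no item (`proof.conditional`); BSD is NOT proved by any of this.

## What is proved

* `signedKatoDivisibilityUpToAtTwo_of_localRobustPackageTwo_rat_of_pub` — per `(D, 𝔭)`: `I, P, ι, col, j, s, m` with (Col) `ker ι`
  killed by `2^m`, (Rec) `2^m · j ∘ col = 0`, (LocCover at `𝔭`) «if `D.toDual x` kills every `t ∈ Sel⁺(E/ℚ_∞)` with
  `res_{Gal(ℚ̄/ℚ_∞) ⊓ D_v} t = 0` then `2^m · x ∈ range j`» (`v` the place of `ℚ` above `2`), and the zeta inequality for a genuine
  class ⟹ K3.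
* `signedKatoDivisibilityUpToAtTwo_of_localRobustZetaSpanPackageTwo_rat_of_pub` — the PRINT SHAPE (one `P, ι, col, m` per curve,
  `j` per `D`, zeta clause on the span of the genuine classes).

References: [Kobayashi2003] §2 p. 4, (7.17)–(7.21), Thm. 7.3 (pp. 12–13); [Kato2004Asterisque] Thm. 13.4 (2) (p. 226); [Washington1997]
§13.1; [GreenbergLNM1716] §2 Prop. 2.1; [Darmon2004] Thm. 3.22.
-/

set_option autoImplicit false
-- the Theorems namespace of this sub repeats the summit name by design (D-0017 nested layout)
set_option linter.dupNamespace false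

noncomputable section

open scoped Classical MatrixGroups ModularForm NumberField

open CongruenceSubgroup WeierstrassCurve Field IsDedekindDomain NumberField
  Literature.NumberTheory.GaloisRepresentations
  Literature.NumberTheory.EllipticCurves Literature.NumberTheory.EllipticCurves.ModularForms
  Literature.NumberTheory.EllipticCurves.Module Literature.NumberTheory.EllipticCurves.Rank1Residual
  Literature.NumberTheory.EllipticCurves.Kobayashi2003 Literature.NumberTheory.EllipticCurves.Kato2004
  Literature.NumberTheory.EllipticCurves.Kato2004.EulerSystemValues Literature.NumberTheory.EllipticCurves.GreenbergSelmer
  ZpExtension Summit.BirchSwinnertonDyer.Rank1Residual.Supersingular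
  Summit.BirchSwinnertonDyer.BirchSwinnertonDyer.Theses.ThetaPartnerAtTwo

namespace Summit.BirchSwinnertonDyer.BirchSwinnertonDyer.Theorems

namespace SignedKatoOffTwo

/-- **K3 BY NAME, MODULO PRINT, from the LOCALISED `2`-robust package in the ONE-PLACE currency.** As
`signedKatoDivisibilityUpToAtTwo_of_localRobustPackageTwo_of_pub`, with the local cover hypothesis stated at the single prime of
`ℚ_∞` above `2`: «`D.toDual x` kills every `t ∈ Sel⁺(E/ℚ_∞)` whose restriction to `Gal(ℚ̄/ℚ_∞) ⊓ D_v` vanishes ⟹ `2^m · x ∈ range j`»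
(`v` = any/the place of `ℚ` containing `2`). [cite: Kobayashi2003, §2 p. 4, (7.17)–(7.21) (pp. 12–13)]
[cite: Kato2004Asterisque, Thm. 13.4 (2) (p. 226)] [cite: Washington1997, §13.1] [cite: Darmon2004, Thm. 3.22] -/
theorem signedKatoDivisibilityUpToAtTwo_of_localRobustPackageTwo_rat_of_pub
    (h134 : Kato2004.thm13_4_two_lengthAt_fineSelmerDual_le_of_isEulerSystemClassTwo)
    (h17 : rank_eq_analyticRank_of_analyticRank_le_one)
    (v : HeightOneSpectrum (𝓞 ℚ)) (hv : ((2 : ℕ) : 𝓞 ℚ) ∈ v.asIdeal)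
    (hR : ∀ (W : WeierstrassCurve ℚ) [W.IsElliptic] [W.IsGloballyMinimal],
      ¬ W.HasCM → W.analyticRank = 0 → GoodSS W 2 → W.frobeniusTrace 2 = 0 →
      ∀ (κ : ZpExtension ℚ 2) (γ : Field.absoluteGaloisGroup ℚ) (hκ : κ.IsCyclotomic),
        κ.IsTopGenerator γ → IsCyclotomicVariable 2 γ →
        ∀ [NeZero (W.conductorNorm ℤ)] (f : CuspForm (Gamma0 (W.conductorNorm ℤ)) 2),
          IsNewformOf W f → ∀ (ϖ : ℚ), (ϖ : ℝ) * W.realPeriodRat = plusPeriod f →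
        ∀ (Lplus Lminus : IwasawaAlgebra 2), IsPollackPair f 2 Lplus Lminus →
        ∀ (D : SignedSelmerDualData W κ γ 1) [ContinuousSMul ℤ_[2] (W.tateModule 2)]
          [Module.Free ℤ_[2] (W.tateModule 2)] [Module.Finite ℤ_[2] (W.tateModule 2)],
          Module.IsTorsion (IwasawaAlgebra 2) D.X →
          ∀ 𝔭 : PrimeSpectrum (IwasawaAlgebra 2), 𝔭.asIdeal.height = 1 →
            PowerSeries.C (2 : ℤ_[2]) ∉ 𝔭.asIdeal →
          ∃ (I : Kato2004.IwasawaH1Data W 2 κ γ)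
            (P : Type) (_ : AddCommGroup P) (_ : _root_.Module (IwasawaAlgebra 2) P)
            (ι : P →ₗ[IwasawaAlgebra 2] IwasawaAlgebra 2) (col : I.H →ₗ[IwasawaAlgebra 2] P)
            (j : P →ₗ[IwasawaAlgebra 2] D.X) (s : I.H) (m : ℕ),
            (∀ y, ι y = 0 → (PowerSeries.C (2 : ℤ_[2]) : IwasawaAlgebra 2) ^ m • y = 0) ∧
            (∀ x, (PowerSeries.C (2 : ℤ_[2]) : IwasawaAlgebra 2) ^ m • j (col x) = 0) ∧
            (∀ x : D.X,
              (∀ t : signedSelmerInfty W κ 1,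
                resOfLe (W.geomPrimaryTorsion 2) (inf_le_left : κ.kerSubgroup ⊓ decomp v ≤ κ.kerSubgroup)
                  (t : W.subgroupH1 2 κ.kerSubgroup) = 0 → D.toDual x t = 0) →
              (PowerSeries.C (2 : ℤ_[2]) : IwasawaAlgebra 2) ^ m • x ∈ LinearMap.range j) ∧
            Kato2004.IsEulerSystemClassTwo W hκ I s ∧
            lengthAt (IwasawaAlgebra 2) (IwasawaAlgebra 2 ⧸ Ideal.span {ι (col s)}) 𝔭 ≤
              lengthAt (IwasawaAlgebra 2) (IwasawaAlgebra 2 ⧸ Ideal.span {kobayashiL 1 Lplus Lminus}) 𝔭) :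
    SignedKatoDivisibilityUpToAtTwo := by
  refine signedKatoDivisibilityUpToAtTwo_of_localRobustPackageTwo_of_pub h134 h17
    fun W _ _ hcm hr hss ha κ γ hκ hγ hcv _ f hf ϖ hϖ Lplus Lminus hPP D _ _ _ hX 𝔭 h𝔭 hp𝔭 ↦ ?_
  obtain ⟨I, P, _, _, ι, col, j, s, m, hι, hcj, hloc, hES, hdiv⟩ :=
    hR W hcm hr hss ha κ γ hκ hγ hcv f hf ϖ hϖ Lplus Lminus hPP D hX 𝔭 h𝔭 hp𝔭
  refine ⟨I, P, inferInstance, inferInstance, ι, col, j, s, m, hι, hcj, fun x hx ↦ ?_, hES, hdiv⟩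
  exact FineStrictRat.localCover_of_localCover_resOfLe_rat W κ 1 hκ v hv D x (hloc x) hx

/-- **K3 BY NAME, MODULO PRINT, from the LOCALISED `2`-robust package IN THE SHAPE OF THE PRINT, ONE-PLACE currency**: one `P, ι,
col, m` per curve, `j` per `D` with reciprocity and the local cover at the single prime above `2`, zeta clause on the span of the
genuine `2`-adic Euler-system classes. [cite: Kobayashi2003, Thm. 6.2–6.3 (p. 11), (7.17)–(7.21), Thm. 7.3 (pp. 12–13)]
[cite: Kato2004Asterisque, Thm. 12.5–12.6 (p. 222), Thm. 13.4 (2) (p. 226)] [cite: Sprung2012, Def. 6.1 (p. 1495), §7 (p. 1499)]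
[cite: Washington1997, §13.1] [cite: Darmon2004, Thm. 3.22] -/
theorem signedKatoDivisibilityUpToAtTwo_of_localRobustZetaSpanPackageTwo_rat_of_pub
    (h134 : Kato2004.thm13_4_two_lengthAt_fineSelmerDual_le_of_isEulerSystemClassTwo)
    (h17 : rank_eq_analyticRank_of_analyticRank_le_one)
    (v : HeightOneSpectrum (𝓞 ℚ)) (hv : ((2 : ℕ) : 𝓞 ℚ) ∈ v.asIdeal)
    (hCK : ∀ (W : WeierstrassCurve ℚ) [W.IsElliptic] [W.IsGloballyMinimal],
      ¬ W.HasCM → W.analyticRank = 0 → GoodSS W 2 → W.frobeniusTrace 2 = 0 →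
      ∀ (κ : ZpExtension ℚ 2) (γ : Field.absoluteGaloisGroup ℚ) (hκ : κ.IsCyclotomic),
        κ.IsTopGenerator γ → IsCyclotomicVariable 2 γ →
        ∀ [NeZero (W.conductorNorm ℤ)] (f : CuspForm (Gamma0 (W.conductorNorm ℤ)) 2),
          IsNewformOf W f → ∀ (ϖ : ℚ), (ϖ : ℝ) * W.realPeriodRat = plusPeriod f →
        ∀ (Lplus Lminus : IwasawaAlgebra 2), IsPollackPair f 2 Lplus Lminus →
        ∀ [ContinuousSMul ℤ_[2] (W.tateModule 2)] [Module.Free ℤ_[2] (W.tateModule 2)]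
          [Module.Finite ℤ_[2] (W.tateModule 2)],
        ∃ (I : Kato2004.IwasawaH1Data W 2 κ γ)
          (P : Type) (_ : AddCommGroup P) (_ : _root_.Module (IwasawaAlgebra 2) P)
          (ι : P →ₗ[IwasawaAlgebra 2] IwasawaAlgebra 2) (col : I.H →ₗ[IwasawaAlgebra 2] P) (m : ℕ),
          (∀ y, ι y = 0 → (PowerSeries.C (2 : ℤ_[2]) : IwasawaAlgebra 2) ^ m • y = 0) ∧
          (∀ (D : SignedSelmerDualData W κ γ 1), Module.IsTorsion (IwasawaAlgebra 2) D.X →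
            ∃ (j : P →ₗ[IwasawaAlgebra 2] D.X),
              (∀ x, (PowerSeries.C (2 : ℤ_[2]) : IwasawaAlgebra 2) ^ m • j (col x) = 0) ∧
              (∀ x : D.X,
                (∀ t : signedSelmerInfty W κ 1,
                  resOfLe (W.geomPrimaryTorsion 2) (inf_le_left : κ.kerSubgroup ⊓ decomp v ≤ κ.kerSubgroup)
                    (t : W.subgroupH1 2 κ.kerSubgroup) = 0 → D.toDual x t = 0) →
                (PowerSeries.C (2 : ℤ_[2]) : IwasawaAlgebra 2) ^ m • x ∈ LinearMap.range j)) ∧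
          (∀ 𝔭 : PrimeSpectrum (IwasawaAlgebra 2), 𝔭.asIdeal.height = 1 →
            PowerSeries.C (2 : ℤ_[2]) ∉ 𝔭.asIdeal →
            ∃ z ∈ Submodule.span (IwasawaAlgebra 2) {g : I.H | Kato2004.IsEulerSystemClassTwo W hκ I g},
              lengthAt (IwasawaAlgebra 2) (IwasawaAlgebra 2 ⧸ Ideal.span {ι (col z)}) 𝔭 ≤
                lengthAt (IwasawaAlgebra 2) (IwasawaAlgebra 2 ⧸ Ideal.span {kobayashiL 1 Lplus Lminus}) 𝔭)) :
    SignedKatoDivisibilityUpToAtTwo := by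
  refine signedKatoDivisibilityUpToAtTwo_of_localRobustZetaSpanPackageTwo_of_pub h134 h17
    fun W _ _ hcm hr hss ha κ γ hκ hγ hcv _ f hf ϖ hϖ Lplus Lminus hPP _ _ _ ↦ ?_
  obtain ⟨I, P, _, _, ι, col, m, hι, hPT, hZ⟩ := hCK W hcm hr hss ha κ γ hκ hγ hcv f hf ϖ hϖ Lplus Lminus hPP
  refine ⟨I, P, inferInstance, inferInstance, ι, col, m, hι, fun D hX ↦ ?_, hZ⟩
  obtain ⟨j, hcj, hloc⟩ := hPT D hX
  exact ⟨j, hcj, fun x hx ↦ FineStrictRat.localCover_of_localCover_resOfLe_rat W κ 1 hκ v hv D x (hloc x) hx⟩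

end SignedKatoOffTwo

end Summit.BirchSwinnertonDyer.BirchSwinnertonDyer.Theorems

end
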